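import Literature.AlgebraicGeometry.Resolution.MuPTorsorOpenCore
import Literature.AlgebraicGeometry.Resolution.ZariskiPatchingProperModelsWeakLU
import Summits.ResolutionOfSingularities.ResolutionOfSingularities.Theorems.SoloInformedRankOne
import HarnessLib

/-!
# Resolution in characteristic `p` = proper two-model patching ∧ the core `μ_p`-torsor step on
# the OPEN CORE: rank-one, residually algebraic valuation rings, not discrete with separable residue field

Summit-side packaging of `Literature/…/MuPTorsorOpenCore.lean`: on top of `SoloInformedRankOne` and
`ResiduallyAlgebraicReduction` (rank one; residually algebraic) the ARCS THROUGH SEPARABLE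
POINTS — valuation rings which are discrete valuation rings with residue field finite
separable over `k` — are removed from the local conjunct, at the price of one more published
theorem taken as a hypothesis: Knaf–Kuhlmann 2009, Thm. 1.5 (places in the completion of an
Abhyankar subfield with separable residue field extension admit local uniformization in every
characteristic and dimension; named fact `KnafKuhlmann2009MonogenicCompletion`, whose
hypotheses are PROVED for such discrete valuation rings in
`Literature/…/DiscreteSeparableResidueLocalUniformization.lean`).

* `openCoreRelCoreSteps_of_resolutionInChar` — resolution in characteristic `p` implies the core
  model-form steps on the open core (unconditional);
* `resolutionInChar_iff_twoModelPatching_and_openCoreRelCoreSteps` — **the split at the open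
  core**: granted `Temkin2013HeightLeOne`, `CossartPiltant2019LU3` and
  `KnafKuhlmann2009MonogenicCompletion`,
  `ResolutionInChar p ↔ ProperModel.TwoModelPatching p ∧ (core model-form μ_p-torsor steps at
  the valuation rings O ⊇ k of finitely generated K/k, char k = p, of rank one, residually
  algebraic over k, and not discrete with residue field finite separable over k)`;
  `resolutionOfSingularities_iff_twoModelPatching_and_openCoreRelCoreSteps` — the same for the
  summit statement itself (all primes, universe `0`).

What is left in the local conjunct: `k`-trivial valuations `v : K ↪ κ((t^Γ))`, `Γ ⊆ ℝ`, `κ/k`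
algebraic, not (`Γ = ℤ` and `κ/k` finite separable), of positive transcendence defect, tested on one `μ_p`-torsor
`A₀[a]`, `a^p ∈ A₀`, over a prescribed regular finitely generated `A₀ ⊆ O`, `trdeg Frac A₀ ≥ 4`.
-/

noncomputable section

namespace Summit.ResolutionOfSingularities.ResolutionOfSingularities.Theorems

open CategoryTheory AlgebraicGeometry IsLocalRing
open Literature.AlgebraicGeometry Literature.AlgebraicGeometry.Resolution

universe u

/-- Resolution in characteristic `p` implies the core model-form torsor steps on the open core
(rank-one, residually algebraic, not discrete with finite separable residue field extension) —
unconditional. -/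
theorem openCoreRelCoreSteps_of_resolutionInChar {p : ℕ} [Fact p.Prime]
    (h : ResolutionInChar.{0} p) :
    ∀ (k K : Type) [Field k] [CharP k p] [Field K] [Algebra k K],
      (⊤ : IntermediateField k K).FG → ∀ O : ValuationSubring K,
        Nonempty O.valuation.RankOne → (∀ c : k, algebraMap k K c ∈ O) →
          IsResiduallyAlgebraic k O → ¬ IsDiscreteWithSeparableResidue k O →
              RelMuPTorsorCoreStepsAt p k O :=
  fun k K _ _ _ _ _ O _ hk _ _ => relCoreSteps_of_resolutionInChar h k K O hk

/-- **Core steps on the open core (over `k` and its finitely generated extensions) + Temkin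
(height one) + Cossart–Piltant (dim ≤ 3) + Knaf–Kuhlmann (discrete places with finite separable
residue field extension) + proper two-model patching over `k` ⇒ weak resolution over `k` in
every dimension** (universe `0`). The local
hypothesis is quantified over all ground fields of characteristic `p` because the reduction
enlarges the ground field inside `O`. -/
theorem resolutionOverUpToDim_of_openCoreRelCoreSteps_of_properPatching {p : ℕ}
    [Fact p.Prime] (hT₁ : Temkin2013HeightLeOne.{0}) (hCP : CossartPiltant2019LU3.{0})
    (hKK : KnafKuhlmann2009MonogenicCompletion)
    (H : ∀ (k K : Type) [Field k] [CharP k p] [Field K] [Algebra k K],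
      (⊤ : IntermediateField k K).FG → ∀ O : ValuationSubring K,
        Nonempty O.valuation.RankOne → (∀ c : k, algebraMap k K c ∈ O) →
          IsResiduallyAlgebraic k O → ¬ IsDiscreteWithSeparableResidue k O →
              RelMuPTorsorCoreStepsAt p k O)
    {k : Type} [Field k] [CharP k p]
    (hZ : ∀ (K : Type) [Field K] [Algebra k K] [Algebra.EssFiniteType k K],
      ∀ M₁ M₂ : ProperModel k K,
        ∃ (N : ProperModel k K) (φ₁ : N.Hom M₁) (φ₂ : N.Hom M₂), φ₁.RegLe ∧ φ₂.RegLe)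
    (d : ℕ) : ResolutionOverUpToDim k d :=
  resolutionOverUpToDim_of_properPatching_of_lu hZ
    (fun K _ _ hfg O hO => isLocallyUniformizable_of_relLocalUniformization hfg O hO
      (relLocalUniformization_of_openCore_relCoreSteps hT₁ hCP hKK H k K O))
    d

/-- **The split of the summit's `p`-component at the open core.** Granted Temkin's
inseparable local uniformization in height one, Cossart–Piltant's resolution in dimension
`≤ 3` and Knaf–Kuhlmann's uniformization of places in the completion of an Abhyankar subfield,
resolution of singularities in characteristic `p` is EQUIVALENT to the conjunction of
(global) two-model patching of proper models and (local) the core model-form `μ_p`-torsor steps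
on the open core (rank-one, residually algebraic valuation rings, not discrete with finite
separable residue field extension, of
finitely generated extensions), over all fields of characteristic `p`. -/
theorem resolutionInChar_iff_twoModelPatching_and_openCoreRelCoreSteps {p : ℕ}
    [Fact p.Prime] (hT₁ : Temkin2013HeightLeOne.{0}) (hCP : CossartPiltant2019LU3.{0})
    (hKK : KnafKuhlmann2009MonogenicCompletion) :
    ResolutionInChar.{0} p ↔ ProperModel.TwoModelPatching.{0} p ∧
      (∀ (k K : Type) [Field k] [CharP k p] [Field K] [Algebra k K],
        (⊤ : IntermediateField k K).FG → ∀ O : ValuationSubring K,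
          Nonempty O.valuation.RankOne → (∀ c : k, algebraMap k K c ∈ O) →
            IsResiduallyAlgebraic k O → ¬ IsDiscreteWithSeparableResidue k O →
              RelMuPTorsorCoreStepsAt p k O) :=
  ⟨fun h => ⟨ProperModel.twoModelPatching_of_resolutionInChar h,
      openCoreRelCoreSteps_of_resolutionInChar h⟩,
    fun h => resolutionInChar_of_properTwoModelPatching_of_lu h.1
      (localUniformizationInChar_of_openCore_relCoreSteps hT₁ hCP hKK h.2)⟩

/-- The same granted the full relative theorem `Temkin2013Relative`, the full Cossart–Piltant
theorem `CossartPiltant2019` and `KnafKuhlmann2009MonogenicCompletion`. -/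
theorem resolutionInChar_iff_twoModelPatching_and_openCoreRelCoreSteps' {p : ℕ}
    [Fact p.Prime] (hT : Temkin2013Relative.{0}) (hCP : CossartPiltant2019.{0})
    (hKK : KnafKuhlmann2009MonogenicCompletion) :
    ResolutionInChar.{0} p ↔ ProperModel.TwoModelPatching.{0} p ∧
      (∀ (k K : Type) [Field k] [CharP k p] [Field K] [Algebra k K],
        (⊤ : IntermediateField k K).FG → ∀ O : ValuationSubring K,
          Nonempty O.valuation.RankOne → (∀ c : k, algebraMap k K c ∈ O) →
            IsResiduallyAlgebraic k O → ¬ IsDiscreteWithSeparableResidue k O →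
              RelMuPTorsorCoreStepsAt p k O) :=
  resolutionInChar_iff_twoModelPatching_and_openCoreRelCoreSteps (hT.heightLE 1) hCP.lu3 hKK

/-- **Exact local proxy at the open core.** Granted Temkin (height one), Cossart–Piltant
(dim ≤ 3) and Knaf–Kuhlmann (discrete places with finite separable residue field extension):
relative local uniformization in
characteristic `p` (all ground fields) is EQUIVALENT to the core model-form steps on the open
core, and resolution in characteristic `p` implies both. -/
theorem resolutionInChar_localProxy_openCore {p : ℕ} [Fact p.Prime]
    (hT₁ : Temkin2013HeightLeOne.{0}) (hCP : CossartPiltant2019LU3.{0})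
    (hKK : KnafKuhlmann2009MonogenicCompletion) :
    (ResolutionInChar.{0} p →
      ∀ (k K : Type) [Field k] [CharP k p] [Field K] [Algebra k K],
        (⊤ : IntermediateField k K).FG → ∀ O : ValuationSubring K,
          Nonempty O.valuation.RankOne → (∀ c : k, algebraMap k K c ∈ O) →
            IsResiduallyAlgebraic k O → ¬ IsDiscreteWithSeparableResidue k O →
              RelMuPTorsorCoreStepsAt p k O) ∧
      ((∀ (k K : Type) [Field k] [CharP k p] [Field K] [Algebra k K] (O : ValuationSubring K),
          (∀ c : k, algebraMap k K c ∈ O) → RelLocalUniformization k K O) ↔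
        ∀ (k K : Type) [Field k] [CharP k p] [Field K] [Algebra k K],
          (⊤ : IntermediateField k K).FG → ∀ O : ValuationSubring K,
            Nonempty O.valuation.RankOne → (∀ c : k, algebraMap k K c ∈ O) →
              IsResiduallyAlgebraic k O → ¬ IsDiscreteWithSeparableResidue k O →
              RelMuPTorsorCoreStepsAt p k O) :=
  ⟨openCoreRelCoreSteps_of_resolutionInChar,
    relLocalUniformization_iff_openCore_relCoreSteps hT₁ hCP hKK⟩

/-- **The summit itself, split at the open core.** Granted Temkin (height one),
Cossart–Piltant (dim ≤ 3) and Knaf–Kuhlmann 2009 Thm. 1.5 (monogenic Abhyankar subfields), in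
universe `0`: resolution of singularities in positive
characteristic (the summit statement, verbatim
`Literature.AlgebraicGeometry.Resolution.ResolutionOfSingularities`) is EQUIVALENT to: for every
prime `p`, two-model patching of proper models in characteristic `p` AND the core model-form
`μ_p`-torsor steps at the rank-one, residually algebraic valuation rings, not discrete with
finite separable residue field extension, of finitely
generated extensions of fields of characteristic `p`. -/
theorem resolutionOfSingularities_iff_twoModelPatching_and_openCoreRelCoreSteps
    (hT₁ : Temkin2013HeightLeOne.{0}) (hCP : CossartPiltant2019LU3.{0})
    (hKK : KnafKuhlmann2009MonogenicCompletion) :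
    Literature.AlgebraicGeometry.Resolution.ResolutionOfSingularities ↔
      ∀ p : ℕ, p.Prime → ProperModel.TwoModelPatching.{0} p ∧
      (∀ (k K : Type) [Field k] [CharP k p] [Field K] [Algebra k K],
        (⊤ : IntermediateField k K).FG → ∀ O : ValuationSubring K,
          Nonempty O.valuation.RankOne → (∀ c : k, algebraMap k K c ∈ O) →
            IsResiduallyAlgebraic k O → ¬ IsDiscreteWithSeparableResidue k O →
              RelMuPTorsorCoreStepsAt p k O) := by
  refine forall_congr' fun p => forall_congr' fun hp => ?_
  haveI : Fact p.Prime := ⟨hp⟩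
  exact resolutionInChar_iff_twoModelPatching_and_openCoreRelCoreSteps hT₁ hCP hKK

end Summit.ResolutionOfSingularities.ResolutionOfSingularities.Theorems

end
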